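import Mathlib
import Summits.Ventures.PercRepro2.Defs

/-!
# FREE BITS: a counting inequality restricted to a pattern on bits that nothing sees
(blind cell PercRepro2, night-4 g30, 2026-08-28; proofs/NIGHT4-G30.md)

Let `D` be a set of edges, `S` a finite set of configurations SATURATED on `D` (membership does not
depend on the bits on `D`), `P` a predicate blind to the bits on `D`, and `Pat` a predicate that
depends ONLY on the bits on `D`.  Then `#{ζ ∈ S : P ζ ∧ Pat ζ} = #{patterns on D with Pat} · #{ζ ∈ S :
P ζ, bits on D all false}` (`card_filter_filter_eq_card_pats_mul`): the fibres over the patterns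
(`dpart`) all have the size of the fibre over the zero pattern, through `patch`.  Hence a counting
inequality `#{S : P_R} ≤ #{S : P_B}` between two such predicates restricts to every pattern
(`card_filter_le_of_free_bits`) — the form in which row 2′SW-ALL of a graph with an isolated
vertex `x` (its edges are loops) restricts to a prescribed colouring of the edges at `x`
(`SwAllHMarkThm`).
-/

namespace Summit.Ventures.PercRepro2

namespace LocRows

variable {E : Type*}

open scoped Classical

/-- The bits of `ζ` on `D`, the others set to `false`. -/
noncomputable def dpart (D : Set E) (ζ : Config E) : Config E :=
  fun e => if e ∈ D then ζ e else false

/-- `ζ` with the bits on `D` replaced by those of `d`. -/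
noncomputable def patch (D : Set E) (d ζ : Config E) : Config E :=
  fun e => if e ∈ D then d e else ζ e

variable {D : Set E}

/-- `dpart` on `D`. -/
lemma dpart_apply_of_mem {ζ : Config E} {e : E} (he : e ∈ D) : dpart D ζ e = ζ e := by
  simp only [dpart, if_pos he]

/-- `dpart` off `D`. -/
lemma dpart_apply_of_notMem {ζ : Config E} {e : E} (he : e ∉ D) : dpart D ζ e = false := by
  simp only [dpart, if_neg he]

/-- `patch` on `D`. -/
lemma patch_apply_of_mem {d ζ : Config E} {e : E} (he : e ∈ D) : patch D d ζ e = d e := by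
  simp only [patch, if_pos he]

/-- `patch` off `D`. -/
lemma patch_apply_of_notMem {d ζ : Config E} {e : E} (he : e ∉ D) : patch D d ζ e = ζ e := by
  simp only [patch, if_neg he]

/-- Patching with the own pattern is the identity. -/
lemma patch_dpart (ζ : Config E) : patch D (dpart D ζ) ζ = ζ := by
  funext e
  by_cases he : e ∈ D
  · rw [patch_apply_of_mem he, dpart_apply_of_mem he]
  · rw [patch_apply_of_notMem he]

/-- Patching twice keeps the last pattern. -/
lemma patch_patch (d d' ζ : Config E) : patch D d (patch D d' ζ) = patch D d ζ := by
  funext e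
  by_cases he : e ∈ D
  · rw [patch_apply_of_mem he, patch_apply_of_mem he]
  · rw [patch_apply_of_notMem he, patch_apply_of_notMem he, patch_apply_of_notMem he]

variable [Fintype E] [DecidableEq E]

/-- The bit patterns on `D`: the configurations vanishing off `D`. -/
noncomputable def pats (D : Set E) : Finset (Config E) :=
  Finset.univ.filter fun d => ∀ e, e ∉ D → d e = false

/-- Membership in the patterns. -/
lemma mem_pats {d : Config E} : d ∈ pats D ↔ ∀ e, e ∉ D → d e = false := by
  simp only [pats, Finset.mem_filter, Finset.mem_univ, true_and]

/-- `dpart` is a pattern. -/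
lemma dpart_mem_pats (ζ : Config E) : dpart D ζ ∈ pats D :=
  mem_pats.2 fun _ he => dpart_apply_of_notMem he

/-- The zero pattern. -/
lemma zero_mem_pats : (fun _ => false : Config E) ∈ pats D := mem_pats.2 fun _ _ => rfl

/-- `dpart` of a patch is the pattern. -/
lemma dpart_patch {d : Config E} (hd : d ∈ pats D) (ζ : Config E) : dpart D (patch D d ζ) = d := by
  funext e
  by_cases he : e ∈ D
  · rw [dpart_apply_of_mem he, patch_apply_of_mem he]
  · rw [dpart_apply_of_notMem he, mem_pats.1 hd e he]

/-- **FREE BITS, the identity**: on a set saturated on `D`, for a predicate blind to the bits on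
`D` and a predicate depending only on them, the count is the number of admissible patterns times
the count at the zero pattern. -/
theorem card_filter_filter_eq_card_pats_mul (S : Finset (Config E))
    (hS : ∀ ζ ∈ S, ∀ ζ', (∀ e, e ∉ D → ζ' e = ζ e) → ζ' ∈ S)
    (P : Config E → Prop) (hP : ∀ ζ ζ', (∀ e, e ∉ D → ζ' e = ζ e) → P ζ → P ζ')
    (Pat : Config E → Prop) (hPat : ∀ ζ ζ', (∀ e, e ∈ D → ζ' e = ζ e) → Pat ζ → Pat ζ') :
    ((S.filter P).filter Pat).card =
      ((pats D).filter Pat).card *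
        ((S.filter P).filter fun ζ => ∀ e, e ∈ D → ζ e = false).card := by
  rw [Finset.card_eq_sum_card_fiberwise (f := dpart D) (t := (pats D).filter Pat)]
  · refine Finset.sum_const_nat ?_
    intro d hd
    rw [Finset.mem_filter] at hd
    refine Finset.card_bij' (fun ζ _ => patch D (fun _ => false) ζ) (fun ζ _ => patch D d ζ)
      ?_ ?_ ?_ ?_
    · intro ζ hζ
      simp only [Finset.mem_filter] at hζ ⊢
      obtain ⟨⟨⟨hζS, hζP⟩, -⟩, -⟩ := hζ
      have hag : ∀ e, e ∉ D → patch D (fun _ => false) ζ e = ζ e :=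
        fun _ he => patch_apply_of_notMem he
      exact ⟨⟨hS ζ hζS _ hag, hP ζ _ hag hζP⟩, fun _ he => patch_apply_of_mem he⟩
    · intro ζ hζ
      simp only [Finset.mem_filter] at hζ ⊢
      obtain ⟨⟨hζS, hζP⟩, -⟩ := hζ
      have hag : ∀ e, e ∉ D → patch D d ζ e = ζ e := fun _ he => patch_apply_of_notMem he
      exact ⟨⟨⟨hS ζ hζS _ hag, hP ζ _ hag hζP⟩,
        hPat d _ (fun _ he => patch_apply_of_mem he) hd.2⟩, dpart_patch hd.1 ζ⟩
    · intro ζ hζ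
      simp only [Finset.mem_filter] at hζ
      rw [patch_patch, ← hζ.2, patch_dpart]
    · intro ζ hζ
      simp only [Finset.mem_filter] at hζ
      rw [patch_patch]
      funext e
      by_cases he : e ∈ D
      · rw [patch_apply_of_mem he, hζ.2 e he]
      · rw [patch_apply_of_notMem he]
  · intro ζ hζ
    rw [Finset.mem_coe, Finset.mem_filter] at hζ ⊢
    exact ⟨dpart_mem_pats ζ, hPat ζ _ (fun _ he => dpart_apply_of_mem he) hζ.2⟩

/-- **FREE BITS, the unrestricted count**: the count on a set saturated on `D`, for a predicate
blind to the bits on `D`, is the number of patterns times the count at the zero pattern. -/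
theorem card_filter_eq_card_pats_mul (S : Finset (Config E))
    (hS : ∀ ζ ∈ S, ∀ ζ', (∀ e, e ∉ D → ζ' e = ζ e) → ζ' ∈ S)
    (P : Config E → Prop) (hP : ∀ ζ ζ', (∀ e, e ∉ D → ζ' e = ζ e) → P ζ → P ζ') :
    (S.filter P).card =
      (pats D).card * ((S.filter P).filter fun ζ => ∀ e, e ∈ D → ζ e = false).card := by
  have h := card_filter_filter_eq_card_pats_mul S hS P hP (fun _ => True) fun _ _ _ _ => trivial
  convert h using 2
  · ext ζ
    simp only [Finset.mem_filter, and_true]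
  · congr 1
    ext ζ
    simp only [Finset.mem_filter, and_true]

/-- **FREE BITS, the inequality**: a counting inequality between two predicates blind to the bits
on `D`, on a set saturated on `D`, restricts to every pattern on `D`. -/
theorem card_filter_le_of_free_bits (S : Finset (Config E))
    (hS : ∀ ζ ∈ S, ∀ ζ', (∀ e, e ∉ D → ζ' e = ζ e) → ζ' ∈ S)
    (PR PB : Config E → Prop) (hPR : ∀ ζ ζ', (∀ e, e ∉ D → ζ' e = ζ e) → PR ζ → PR ζ')
    (hPB : ∀ ζ ζ', (∀ e, e ∉ D → ζ' e = ζ e) → PB ζ → PB ζ')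
    (Pat : Config E → Prop) (hPat : ∀ ζ ζ', (∀ e, e ∈ D → ζ' e = ζ e) → Pat ζ → Pat ζ')
    (hle : (S.filter PR).card ≤ (S.filter PB).card) :
    ((S.filter PR).filter Pat).card ≤ ((S.filter PB).filter Pat).card := by
  have eR := card_filter_eq_card_pats_mul S hS PR hPR
  have eB := card_filter_eq_card_pats_mul S hS PB hPB
  have hpos : 0 < (pats D).card := Finset.card_pos.2 ⟨_, zero_mem_pats⟩
  rw [eR, eB] at hle
  have hc := Nat.le_of_mul_le_mul_left hle hpos
  rw [card_filter_filter_eq_card_pats_mul S hS PR hPR Pat hPat,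
    card_filter_filter_eq_card_pats_mul S hS PB hPB Pat hPat]
  exact Nat.mul_le_mul_left _ hc

end LocRows

end Summit.Ventures.PercRepro2
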